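/-
Origin: expansion seat `planner-pub-hodgecm-pv09-g3-0`, handover #7 2026-08-18T05:51:29Z (`HOME/pub-hodgecm-pv09-g3/lean/Pv09g3/CanonicalPieces.lean`, md5 e90b1da5, 318 lines);
landed by the gen-6 packager in gate run 24 as `HodgeCM/PerL34/CanonicalPieces.lean` (import ^import Pv[0-9]+g[0-9]+\.→import HodgeCM.PerL34. ×2).
-/
/-
Copyright: HodgeCM publication cell (pub-hodgecm), DAG node N31 — seam S3 / seam (I) capstone
(prover pv09, gen 3).  Released under the package licence.

# pv13's `LocalFactorPieces` BUILT for the canonical (restricted-product) data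

Source under adjudication (NOT cited as a fact; this file PROVES a typed piece of it):
PerL v5 = `inputs/2001/summits__hodge-w-picard-modular-quadrilinear-period-galois-
closure__free__y1__paper__paper.tex`, Lemma 4.2(b), proof, tex ll. 607–611 and 628–631, verbatim:

  611: ... =\prod_v I_v(\phi_v),\qquad I_v(\phi_v):=\int_{\U(W_i)(L_{0,v})}\langle\omega_v(y)\phi_v,
       \phi_v\rangle\,\chi'_{i,v}(y)\,dy .
  629: unramified, and then $I_v(\phi^0_v)=1$, resp.\ (at split $v$, where $\U(W_i)(L_{0,v})\cong
       L_{0,v}^\times$ acts through the character $\nu_v$ of the splitting and the dilation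
  630: $|y|^{3/2}$ on the Schr\"odinger model) $I_v(\phi^0_v)=\sum_{n\in\Z} q_v^{-3|n|/2}
       (\chi'_{i,v}\nu_v)(\varpi_v)^n=(1-q_v^{-3})\,|1-(\chi'_{i,v}\nu_v)(\varpi_v)q_v^{-3/2}|^{-2}$,

## What this file does

pv13's `EulerFactorisation.LocalFactorPieces V E` (LANDED run 21; its `rallis` field and the S3
constructor `toLocalFactorDatum` are PROVED there) asks for: the adelic shell `(A, μ, 𝓕, ω, φ, χ′, K,
c, θ)` with `hN31e` (pv09) and `hnorm` (pv05); the local integrands `loc`; a restricted-product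
`Datum` `D` with `D_I : D.I v = (loc v).Ic`; and the N31f/N31g local fields `ram_pos`, `split_val`,
`nonsplit_val`, `summable_t`.  For the CANONICAL data of this seat — `A = Πʳ_i [G_i, B_i]`, `μ = D.μ`
(pv11's measure datum), `loc := localIntegrand B D ω φ χ′` (`PureTensorPieces`) — this file BUILDS it:

* `norm_localIntegrand_f` : `‖(localIntegrand i).f g‖ = ‖localCoeff_i g‖` (`χ′` unitary);
* `integral_norm_localCoeff_eq_tsum` : at a split unramified place, FROM pv10's shell hypotheses
  (`UnramifiedFactors.split_integral_eq_tsum`: shells `P n` of volume one partitioning `G_i`, the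
  integrand constant `= q^{-3|n|/2} aⁿ` on `P n` — the tex parenthesis of l. 629–630 made explicit),
  `∫ ‖localCoeff_i‖ dν_i = Σ_{n∈ℤ} q^{-3|n|/2}` — the SERIES form of the split input `hsp` of
  `EulerBound.hB_of_places'` is thus DERIVED from the same shell data that gives the VALUE;
* `localIntegrand_I_eq_tsum` : the VALUE `((localIntegrand i).I : ℂ) = Σ' n, (q^{-3/2})^{|n|} aⁿ` in
  pv13's `split_val` shape (pv10 `split_AX7_shape` + `tParam q = EulerProduct.tOf q`);
* `UnramifiedPlaceData` : the per-place unramified data outside a finite `S` (shells + shell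
  identity at split places; `B_i = G_i`, `ν_i(G_i) = 1` at non-split places; `2 ≤ q_i`, `|χ′_i(ϖ)| =
  |ν_i(ϖ)| = 1`) and its consequences `.hB` (the Euler `L¹` bound — `EulerBound`), `.split_val`,
  `.nonsplit_val` (`UnramifiedNonsplit.localIntegrand_I_eq_one`, from `hK`);
* **`canonicalPieces`** : `LocalFactorPieces ι E` with `A := Πʳ`, `loc := localIntegrand B D ω φ χ′`,
  `D := eulerDatum …` (pv13's `Datum`, BUILT in `PureTensorPieces` via pv11 `toEulerDatum`), `D_I := rfl`,
  every N31g field PRODUCED from `UnramifiedPlaceData`; hence (pv13, by name) **`rallis_canonical`**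
  `re ⟪θ,θ⟫ = c · vol · ∏' I_i`, **`theta_ne_zero_canonical`** `θ ≠ 0`, and `canonicalLocalFactorDatum`.

REMAINING HYPOTHESES of `canonicalPieces` (the honest residual of seam S3 for the canonical data, cf.
LEMMAS §9 S3): global — `hN31e` (pv09 `N31e_holds` produces it for ITS data), `hnorm` (pv05), `c > 0`
(N31d), `0 < vol 𝓕 < ∞`, `θ ∈ Θ`; representation side — `hK` (φ is `K_T`-fixed), `hM` (product formula
on finite sub-products: D4/D5, posited), measurability `hfm`, local integrability `hcl`, `IsCoordinate D`
(pv09-g2 `ofHaar`), `Continuous χ′` and an unramified level `K_{T′} ≤ ker χ′` (EXISTS: pv10);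
per place — `UnramifiedPlaceData` (split: the Schrödinger-model shell identity, pv07/pv10 D4 model
equation; non-split: `B_i = G_i`, `ν_i(G_i) = 1`), `ram_pos` at `v ∈ S` (pv07 `ram_pos_of_placeModels`
gives its field shape for ANY `loc`), `summable_t` (pv13 `EulerProduct.summable_tOf_of_places` PROVES it
for the finite places of a number field: `theta_ne_zero_canonical_of_places` discharges it).  Nothing is cited; no hypothesis names PerL, QW8 or a
2001-programme claim.  Imports: this seat's `SeamIPlaces` (items 1–5) and `UnramifiedNonsplit` (item 6);
axioms = the standard trio.  Unit `pub-hodgecm-pv09-g3` (DAG-node prover #09, generation 3), 2026-08-18.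
-/
import Summits.HodgeConjecture.HodgeCM.PerL34.SeamIPlaces
import Summits.HodgeConjecture.HodgeCM.PerL34.UnramifiedNonsplit

set_option autoImplicit false

noncomputable section

open MeasureTheory Set Filter Function Topology Complex ComplexConjugate

open scoped RestrictedProduct InnerProductSpace

namespace HodgeCM.PerL34.PureTensor

open HodgeCM.PerL34.AdelicFactorisation HodgeCM.PerL34.RestrictedMeasure
  HodgeCM.PerL34.NoSmallSubgroups HodgeCM.PerL34.EulerFactorisation

/-! ## §1 Split unramified places: the `L¹` norm and the value from pv10's shell hypotheses -/

section split

variable {ι : Type} {G : ι → Type} [∀ i, Group (G i)] [DecidableEq ι]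
  {Sub : ι → Type*} [∀ i, SetLike (Sub i) (G i)] [∀ i, SubgroupClass (Sub i) (G i)]
  (B : ∀ i, Sub i)
  {Sp : Type} [NormedAddCommGroup Sp] [InnerProductSpace ℂ Sp]
  (ω : (Πʳ j, [G j, B j]) →* (Sp ≃ₗᵢ[ℂ] Sp)) (φ : Sp)
  [∀ i, MeasurableSpace (G i)] [∀ i, MeasurableInv (G i)]
  (D : RestrictedProductMeasureDatum ι G (Πʳ j, [G j, B j])) [∀ i, (D.ν i).IsInvInvariant]
  (χ : (Πʳ j, [G j, B j]) →* Circle)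

/-- `‖⟪φ, ω(ι_i g)φ⟫ · χ′(ι_i g)‖ = ‖⟪φ, ω(ι_i g)φ⟫‖` (`χ′` is unitary). -/
theorem norm_localIntegrand_f (i : ι) (g : G i) :
    ‖(localIntegrand B D ω φ χ i).f g‖ = ‖localCoeff B ω φ i g‖ := by
  rw [localIntegrand_f, norm_mul, Circle.norm_coe, mul_one]

/-- **Split unramified place, `L¹` norm of the local coefficient from the shells**:
`∫ ‖localCoeff_i‖ dν_i = Σ_{n∈ℤ} (q^{-3/2})^{|n|}` — the series form of the input `hsp` of
`EulerBound.hB_of_places'`. -/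
theorem integral_norm_localCoeff_eq_tsum {i : ι} (P : ℤ → Set (G i))
    (hm : ∀ n, MeasurableSet (P n)) (hd : Pairwise (Disjoint on P)) (hcover : (⋃ n, P n) = Set.univ)
    (hvol : ∀ n, D.ν i (P n) = 1) {q : ℕ} (hq : 2 ≤ q) {a : ℂ} (ha : ‖a‖ = 1)
    (hF : ∀ n : ℤ, Set.EqOn (localIntegrand B D ω φ χ i).f
      (fun _ => ((EulerProduct.tOf q : ℝ) : ℂ) ^ n.natAbs * a ^ n) (P n)) :
    ∫ g, ‖localCoeff B ω φ i g‖ ∂D.ν i = ∑' n : ℤ, EulerProduct.tOf q ^ n.natAbs := by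
  have ht0 := EulerProduct.tOf_nonneg q
  have ht1 := EulerProduct.tOf_lt_one hq
  have hfg : ∀ n : ℤ, Set.EqOn (fun g => ‖localCoeff B ω φ i g‖)
      (fun _ => EulerProduct.tOf q ^ n.natAbs) (P n) := by
    intro n g hg
    have h1 : (localIntegrand B D ω φ χ i).f g =
        ((EulerProduct.tOf q : ℝ) : ℂ) ^ n.natAbs * a ^ n := hF n hg
    show ‖localCoeff B ω φ i g‖ = EulerProduct.tOf q ^ n.natAbs
    rw [← norm_localIntegrand_f B ω φ D χ, h1, UnramifiedFactors.norm_term _ ht0 ha n]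
  have hg : Summable fun n : ℤ => ‖EulerProduct.tOf q ^ n.natAbs‖ :=
    (hasSum_pow_natAbs ht0 ht1).summable.norm
  exact UnramifiedFactors.integral_eq_tsum_of_eqOn_partition hm hd hcover hvol hfg hg

/-- `tParam q` (pv10) `=` `EulerProduct.tOf q` (pv13) `= q^{-3/2}`. -/
theorem ofReal_tParam_eq_tOf {q : ℕ} (hq : 0 < q) :
    (UnramifiedFactors.tParam q : ℂ) = ((EulerProduct.tOf q : ℝ) : ℂ) := by
  rw [UnramifiedFactors.tParam_eq_rpow hq]; rfl

/-- **Split unramified place, the VALUE** (tex l. 630, first equality) in pv13's `split_val` shape: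
`((localIntegrand i).I : ℂ) = Σ' n, (q^{-3/2})^{|n|} aⁿ` — pv10's `split_AX7_shape` for the
canonical local integrand. -/
theorem localIntegrand_I_eq_tsum {i : ι} (P : ℤ → Set (G i))
    (hm : ∀ n, MeasurableSet (P n)) (hd : Pairwise (Disjoint on P)) (hcover : (⋃ n, P n) = Set.univ)
    (hvol : ∀ n, D.ν i (P n) = 1) {q : ℕ} (hq : 2 ≤ q) {a : ℂ} (ha : ‖a‖ = 1)
    (hF : ∀ n : ℤ, Set.EqOn (localIntegrand B D ω φ χ i).f
      (fun _ => ((EulerProduct.tOf q : ℝ) : ℂ) ^ n.natAbs * a ^ n) (P n)) :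
    (((localIntegrand B D ω φ χ i).I : ℝ) : ℂ) =
      ∑' n : ℤ, ((EulerProduct.tOf q : ℝ) : ℂ) ^ n.natAbs * a ^ n := by
  have ht := ofReal_tParam_eq_tOf (q := q) (by omega)
  have hF' : ∀ n : ℤ, Set.EqOn (localIntegrand B D ω φ χ i).f
      (fun _ => (UnramifiedFactors.tParam q : ℂ) ^ n.natAbs * a ^ n) (P n) := by
    rw [ht]; exact hF
  have h := UnramifiedFactors.split_AX7_shape (D.ν i) P hm hd hcover hvol hq ha
    (localIntegrand B D ω φ χ i).f hF'
  rw [ht] at h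
  exact h

end split

/-! ## §2 The per-place unramified data and the canonical `LocalFactorPieces` -/

section pieces

variable {ι : Type} {G : ι → Type} [∀ i, CommGroup (G i)] [∀ i, MeasurableSpace (G i)]
  [∀ i, MeasurableInv (G i)]
  {Sub : ι → Type*} [∀ i, SetLike (Sub i) (G i)] [∀ i, SubgroupClass (Sub i) (G i)]
  (B : ∀ i, Sub i) [DecidableEq ι]
  {Sp : Type} [NormedAddCommGroup Sp] [InnerProductSpace ℂ Sp]
  {E : Type*} [NormedAddCommGroup E] [InnerProductSpace ℂ E]

/-- **Unramified per-place data outside a finite `S`** for the canonical local integrands: at split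
`i ∉ S`, shells `P i n` (volume one, partitioning `G i`) on which the integrand is the constant
`(q_i^{-3/2})^{|n|} (χ′_i(ϖ) ν_i(ϖ))ⁿ` (tex l. 629–630 parenthesis; D4 model identification — an INPUT);
at non-split `i ∉ S`, `B i = G i` and `ν_i(G i) = 1`; and the numerics `2 ≤ q_i`, `|χ′_i(ϖ)| = |ν_i(ϖ)| = 1`. -/
structure UnramifiedPlaceData (D : RestrictedProductMeasureDatum ι G (Πʳ j, [G j, B j]))
    [∀ i, (D.ν i).IsInvInvariant] (ω : (Πʳ j, [G j, B j]) →* (Sp ≃ₗᵢ[ℂ] Sp)) (φ : Sp)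
    (χ : (Πʳ j, [G j, B j]) →* Circle) (S : Finset ι) (q : ι → ℕ) (chiPi nuPi : ι → ℂ)
    (IsSplit : ι → Prop) where
  /-- the shells `ϖⁿ 𝒪^×` at split places -/
  P : ∀ i, ℤ → Set (G i)
  hm : ∀ i, i ∉ S → IsSplit i → ∀ n, MeasurableSet (P i n)
  hd : ∀ i, i ∉ S → IsSplit i → Pairwise (Disjoint on P i)
  hcover : ∀ i, i ∉ S → IsSplit i → (⋃ n, P i n) = Set.univ
  hvol : ∀ i, i ∉ S → IsSplit i → ∀ n, D.ν i (P i n) = 1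
  hF : ∀ i, i ∉ S → IsSplit i → ∀ n : ℤ, Set.EqOn (localIntegrand B D ω φ χ i).f
    (fun _ => ((EulerProduct.tOf (q i) : ℝ) : ℂ) ^ n.natAbs * (chiPi i * nuPi i) ^ n) (P i n)
  hBi : ∀ i, i ∉ S → ¬IsSplit i → (B i : Set (G i)) = Set.univ
  hν1 : ∀ i, i ∉ S → ¬IsSplit i → D.ν i Set.univ = 1
  two_le_q : ∀ i, i ∉ S → 2 ≤ q i
  chi_norm : ∀ i, i ∉ S → ‖chiPi i‖ = 1
  nu_norm : ∀ i, i ∉ S → ‖nuPi i‖ = 1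

namespace UnramifiedPlaceData

variable {B} {D : RestrictedProductMeasureDatum ι G (Πʳ j, [G j, B j])} [∀ i, (D.ν i).IsInvInvariant]
  {ω : (Πʳ j, [G j, B j]) →* (Sp ≃ₗᵢ[ℂ] Sp)} {φ : Sp} {χ : (Πʳ j, [G j, B j]) →* Circle}
  {S : Finset ι} {q : ι → ℕ} {chiPi nuPi : ι → ℂ} {IsSplit : ι → Prop}
  (X : UnramifiedPlaceData B D ω φ χ S q chiPi nuPi IsSplit)

include X

/-- (Ported verbatim from the HodgeCMPerL package; no docstring in the source.) -/
theorem a_norm (i : ι) (hi : i ∉ S) : ‖chiPi i * nuPi i‖ = 1 :=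
  EulerProduct.norm_mul_eq_one (X.chi_norm i hi) (X.nu_norm i hi)

/-- split `L¹` norm (series form) -/
theorem integral_norm_localCoeff (i : ι) (hi : i ∉ S) (hs : IsSplit i) :
    ∫ g, ‖localCoeff B ω φ i g‖ ∂D.ν i = ∑' n : ℤ, EulerProduct.tOf (q i) ^ n.natAbs :=
  integral_norm_localCoeff_eq_tsum B ω φ D χ (X.P i) (X.hm i hi hs) (X.hd i hi hs) (X.hcover i hi hs)
    (X.hvol i hi hs) (X.two_le_q i hi) (X.a_norm i hi) (X.hF i hi hs)

/-- `split_val` for the canonical local factors -/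
theorem split_val (i : ι) (hi : i ∉ S) (hs : IsSplit i) :
    (((localIntegrand B D ω φ χ i).I : ℝ) : ℂ) =
      ∑' n : ℤ, ((EulerProduct.tOf (q i) : ℝ) : ℂ) ^ n.natAbs * (chiPi i * nuPi i) ^ n :=
  localIntegrand_I_eq_tsum B ω φ D χ (X.P i) (X.hm i hi hs) (X.hd i hi hs) (X.hcover i hi hs)
    (X.hvol i hi hs) (X.two_le_q i hi) (X.a_norm i hi) (X.hF i hi hs)

/-- `nonsplit_val` for the canonical local factors (from `hK`, item 6) -/
theorem nonsplit_val (hφ : ‖φ‖ = 1) {T T' : Finset ι}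
    (hK : ∀ k ∈ RestrictedProduct.boxSubgroup B T, ω k φ = φ)
    (hχT' : RestrictedProduct.boxSubgroup B T' ≤ χ.ker) (hTS : T ⊆ S) (hT'S : T' ⊆ S)
    (i : ι) (hi : i ∉ S) (hs : ¬IsSplit i) : (localIntegrand B D ω φ χ i).I = 1 :=
  localIntegrand_I_eq_one B ω φ D χ hφ hK hχT' (fun h => hi (hTS h)) (fun h => hi (hT'S h))
    (X.hBi i hi hs) (X.hν1 i hi hs)

/-- the Euler `L¹` bound `hB` (item 4 `hB_of_places'`) from the place data -/
theorem hB (hφ : ‖φ‖ = 1) (T : Finset ι)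
    (hsum : Summable fun i : {j : ι // j ∉ S} => EulerProduct.tOf (q i.1)) :
    ∃ C : ℝ, ∀ S' : Finset ι, D.S₀ ⊆ S' → T ⊆ S' →
      ∏ i ∈ S', ∫ g, ‖localCoeff B ω φ i g‖ ∂D.ν i ≤ C :=
  hB_of_places' B D ω φ hφ T S IsSplit q X.two_le_q (fun i hi hs => (X.hν1 i hi hs).le)
    (fun i hi hs => X.integral_norm_localCoeff i hi hs) hsum

end UnramifiedPlaceData

variable [∀ i, TopologicalSpace (G i)] [∀ i, OpensMeasurableSpace (G i)] [Countable ι]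
  (hBopen : ∀ i, IsOpen (B i : Set (G i)))
  (D : RestrictedProductMeasureDatum ι G (Πʳ j, [G j, B j])) [∀ i, (D.ν i).IsInvInvariant]
  (hD : IsCoordinate D) (ω : (Πʳ j, [G j, B j]) →* (Sp ≃ₗᵢ[ℂ] Sp)) (φ : Sp) (hφ : ‖φ‖ = 1)
  (χ : (Πʳ j, [G j, B j]) →* Circle) (hχ : Continuous χ)
  (𝓕 : Set (Πʳ j, [G j, B j])) (K : (Πʳ j, [G j, B j]) → (Πʳ j, [G j, B j]) → ℂ) (c : ℝ)
  (c_pos : 0 < c) (vol_ne_zero : D.μ 𝓕 ≠ 0) (vol_ne_top : D.μ 𝓕 ≠ ⊤) (θ : E) (Θ : Set E)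
  (hθ : θ ∈ Θ)
  (hN31e : RallisIP.N31e_statement D.μ 𝓕 ω φ (fun y => ((χ y : Circle) : ℂ)) K (c : ℂ))
  (hnorm : ⟪θ, θ⟫_ℂ = ∫ u in 𝓕, ∫ u' in 𝓕, ((χ u : Circle) : ℂ) * conj ((χ u' : Circle) : ℂ) *
    K u u' ∂D.μ ∂D.μ)
  {T T' : Finset ι} (hK : ∀ k ∈ RestrictedProduct.boxSubgroup B T, ω k φ = φ)
  (hχT' : RestrictedProduct.boxSubgroup B T' ≤ χ.ker)
  (hM : ∀ S : Finset ι, T ⊆ S → ∀ y : (i : ↥S) → G i,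
    inner ℂ φ (ω (extendOne B S y) φ) = ∏ i : ↥S, localCoeff B ω φ i (y i))
  (hfm : AEStronglyMeasurable (fun y => inner ℂ φ (ω y φ) * ((χ y : Circle) : ℂ)) D.μ)
  (hcl : ∀ i, Integrable (localCoeff B ω φ i) (D.ν i))
  {S : Finset ι} {q : ι → ℕ} {chiPi nuPi : ι → ℂ} {IsSplit : ι → Prop}
  (X : UnramifiedPlaceData B D ω φ χ S q chiPi nuPi IsSplit) (hTS : T ⊆ S) (hT'S : T' ⊆ S)
  (ram_pos : ∀ i ∈ S, 0 < (localIntegrand B D ω φ χ i).I)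
  (hsum : Summable fun i : {j : ι // j ∉ S} => EulerProduct.tOf (q i.1))

include hBopen hD hφ hχ c_pos vol_ne_zero vol_ne_top hθ hN31e hnorm hK hχT' hM hfm hcl X hTS hT'S
  ram_pos hsum

/-- **pv13's `LocalFactorPieces` for the canonical restricted-product data** (`A := Πʳ_i [G_i, B_i]`,
`μ := D.μ`, `loc := localIntegrand B D ω φ χ′`, `D := eulerDatum …`, `D_I := rfl`), every N31g field
PRODUCED from the unramified place data `X`. -/
def canonicalPieces : LocalFactorPieces ι E where
  A := Πʳ j, [G j, B j]
  μ := D.μ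
  𝓕 := 𝓕
  Sp := Sp
  ω := ω
  φ := φ
  χ' := fun y => ((χ y : Circle) : ℂ)
  K := K
  c := c
  c_pos := c_pos
  vol_ne_zero := vol_ne_zero
  vol_ne_top := vol_ne_top
  theta := θ
  Theta := Θ
  theta_mem := hθ
  hN31e := hN31e
  hnorm := hnorm
  loc := localIntegrand B D ω φ χ
  D := eulerDatum B hBopen D hD ω φ χ hχ hK hM hfm hcl (X.hB hφ T hsum)
  D_I := fun _ => rfl
  S := S
  q := q
  chiPi := chiPi
  nuPi := nuPi
  IsSplit := IsSplit
  two_le_q := X.two_le_q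
  chi_norm := X.chi_norm
  nu_norm := X.nu_norm
  ram_pos := ram_pos
  split_val := X.split_val
  nonsplit_val := X.nonsplit_val hφ hK hχT' hTS hT'S
  summable_t := hsum

/-- its real local factors are the canonical ones -/
theorem canonicalPieces_I (i : ι) :
    (canonicalPieces B hBopen D hD ω φ hφ χ hχ 𝓕 K c c_pos vol_ne_zero vol_ne_top θ Θ hθ hN31e hnorm
      hK hχT' hM hfm hcl X hTS hT'S ram_pos hsum).I i = (localIntegrand B D ω φ χ i).I := rfl

/-- **Rallis for the canonical data** (pv13 `LocalFactorPieces.rallis`, by name):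
`re ⟪θ, θ⟫ = c · vol([U(W_i)]) · ∏' I_i`. -/
theorem rallis_canonical :
    RCLike.re ⟪θ, θ⟫_ℂ = c * (D.μ 𝓕).toReal * ∏' i, (localIntegrand B D ω φ χ i).I :=
  (canonicalPieces B hBopen D hD ω φ hφ χ hχ 𝓕 K c c_pos vol_ne_zero vol_ne_top θ Θ hθ hN31e hnorm
    hK hχT' hM hfm hcl X hTS hT'S ram_pos hsum).rallis

/-- **pv13's S3 constructor applied**: the `LocalFactorDatum` of the canonical data. -/
def canonicalLocalFactorDatum : EulerProduct.LocalFactorDatum ι E :=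
  (canonicalPieces B hBopen D hD ω φ hφ χ hχ 𝓕 K c c_pos vol_ne_zero vol_ne_top θ Θ hθ hN31e hnorm
    hK hχT' hM hfm hcl X hTS hT'S ram_pos hsum).toLocalFactorDatum

/-- **N31h conclusion for the canonical data** (pv13 `LocalFactorDatum.inner_self_pos` /
`theta_ne_zero`, by name): `0 < re ⟪θ, θ⟫` and `θ ≠ 0`. -/
theorem inner_self_pos_canonical : 0 < RCLike.re ⟪θ, θ⟫_ℂ :=
  (canonicalLocalFactorDatum B hBopen D hD ω φ hφ χ hχ 𝓕 K c c_pos vol_ne_zero vol_ne_top θ Θ hθ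
    hN31e hnorm hK hχT' hM hfm hcl X hTS hT'S ram_pos hsum).inner_self_pos

/-- (Ported verbatim from the HodgeCMPerL package; no docstring in the source.) -/
theorem theta_ne_zero_canonical : θ ≠ 0 :=
  (canonicalLocalFactorDatum B hBopen D hD ω φ hφ χ hχ 𝓕 K c c_pos vol_ne_zero vol_ne_top θ Θ hθ
    hN31e hnorm hK hχT' hM hfm hcl X hTS hT'S ram_pos hsum).theta_ne_zero

omit hsum in
/-- **Number-field places**: if the places outside `S` are (injectively) finite places `v_j` of a
number field `L₀` with `q_j = N(v_j)`, pv13's `EulerProduct.summable_tOf_of_places` DISCHARGES the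
hypothesis `summable_t` (tex l. 631 "`∏_{v∉S} I_v` converges absolutely"). -/
theorem theta_ne_zero_canonical_of_places (L₀ : Type*) [Field L₀] [NumberField L₀]
    (e : {j : ι // j ∉ S} → IsDedekindDomain.HeightOneSpectrum (NumberField.RingOfIntegers L₀))
    (he : Function.Injective e)
    (hq : ∀ j : {j : ι // j ∉ S}, q j.1 = Ideal.absNorm (e j).asIdeal) : θ ≠ 0 :=
  theta_ne_zero_canonical B hBopen D hD ω φ hφ χ hχ 𝓕 K c c_pos vol_ne_zero vol_ne_top θ Θ hθ hN31e
    hnorm hK hχT' hM hfm hcl X hTS hT'S ram_pos (EulerProduct.summable_tOf_of_places L₀ e he hq)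

end pieces

end HodgeCM.PerL34.PureTensor

end
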